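import Summits.BirchSwinnertonDyer.BirchSwinnertonDyer.Theorems.SylvesterTwoHeegnerIndexUpperOffV0ResInjective
import Summits.BirchSwinnertonDyer.BirchSwinnertonDyer.Theorems.SylvesterTwoHeegnerIndexUpperOffV0EisensteinConj
import HarnessLib

/-!
# K7t crux `UpperOffV0HSY` (item 19581), design step (a): the `τ`-eigenspace structure of `E[2^M]`
# under complex conjugation for an `F`-model of `y² = x³ − c`

Route `SylvesterTwoHeegnerIndex` (cell bsd-cm, rung K7t).  In McCallum's descent (1991, §3) at an odd
prime the module `E[p^M]` splits under complex conjugation `τ` as `E[p^M]⁺ ⊕ E[p^M]⁻` with cyclic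
summands of order `p^M` (the tree's `KolyvaginEigen.*`, `IsLiftOfAut.exists_eigenvector_pow`).  At
`p = 2` for the CM curves `y² = x³ − c` this FAILS, and this file proves exactly what replaces it.

* §1 `smul_omegaRot_of_smul_omega_eq_sq` — an element `σ ∈ Γ_F` with `σ(ω) = ω²` acts
  `[ω]`-SEMILINEARLY: `σ([ω]P) = [ω²](σP)`; `exists_omega_geomPoints_semilinear` — `[ω]` on the
  geometric points of any `F`-model `B` (transport along `geomPointsEquiv`), with `[ω]² + [ω] + 1 = 0`,
  commuting with `Γ_{F(ω)}` and semilinear for the other coset; `smul_omega_eq_or` — every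
  `σ ∈ Γ_F` has `σ(ω) ∈ {ω, ω²}`.
* §2 `conj_eigen_structure_twoPow` — for every involution `σ ∈ Γ_F` with `σ(ω) = ω²` (complex
  conjugation when `F ⊂ ℝ`), every `M ≥ 1`: there are `[ω]` on `N = E_B[2^M]` and `P ∈ N` of order
  `2^M` FIXED by `σ` such that `N^{σ=1} = ℤ/2^M·P`, `N^{σ=−1} = ℤ/2^M·(P + 2[ω]P)`, `2N ⊆ N⁺ + N⁻`,
  and `[ω]P ∉ N⁺ + N⁻` — i.e. **both eigenspaces are cyclic of order `2^M` and `[N : N⁺ + N⁻] = 2`**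
  (pure algebra: `EisensteinTorsion.exists_tau_fixed_addOrderOf_eq`, `tau_eq_self_iff`,
  `tau_eq_neg_iff`, `two_smul_mem_eigen_sum`, `theta_not_mem_eigen_sum`).

NOT the crux: these are the inputs (a) of the off-𝒱₀ 2-adic Kolyvagin line; the sharp bound stays open.
-/

noncomputable section

open scoped Classical
open Field WeierstrassCurve Literature.NumberTheory.EllipticCurves
  Literature.NumberTheory.GaloisRepresentations

set_option autoImplicit false
set_option linter.dupNamespace false

namespace Summit.BirchSwinnertonDyer.BirchSwinnertonDyer.Theorems.SylvesterTwoUpper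

universe u

/-! ## §1 Semilinearity of the non-trivial coset of `Γ_{F(ω)}` -/

section Semilinear

variable {F : Type u} [Field F] {V : WeierstrassCurve F}
  (h1 : V.a₁ = 0) (h2 : V.a₂ = 0) (h3 : V.a₃ = 0) (h4 : V.a₄ = 0)
  {ω : AlgebraicClosure F} (hω : ω ^ 2 + ω + 1 = 0)

omit hω in
/-- Every `σ ∈ Γ_F` maps `ω` to `ω` or to `ω²` (the roots of `X² + X + 1`). [folklore] -/
theorem smul_omega_eq_or (hω : ω ^ 2 + ω + 1 = 0) (σ : absoluteGaloisGroup F) :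
    σ • ω = ω ∨ σ • ω = ω ^ 2 := by
  have hr : (σ • ω) ^ 2 + σ • ω + 1 = 0 := by
    have h := congrArg (fun x => σ • x) hω
    simpa only [smul_add, smul_pow', smul_one, smul_zero] using h
  rcases eq_or_eq_of_sq_add_self_add_one hω hr with h | h
  · exact Or.inl h
  · right; rw [h]; linear_combination -hω

/-- **An element `σ ∈ Γ_F` with `σ(ω) = ω²` acts `[ω]`-SEMILINEARLY**: `σ([ω]P) = [ω]([ω](σP))`
on `E(F̄)` for a Mordell equation over `F` and any `θ` acting by `(x, y) ↦ (ωx, y)` with `θ 𝒪 = 𝒪`.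
[folklore] -/
theorem smul_omegaRot_of_smul_omega_eq_sq {θ : geomPoints V → geomPoints V} (hθ0 : θ 0 = 0)
    (hθ : ∀ (x y : AlgebraicClosure F) (h : (V.baseChange (AlgebraicClosure F)).toAffine.Nonsingular x y),
      θ (.some x y h) = .some (ω * x) y (SylvesterTwoCMNormForm.nonsingular_omega_mul hω
        (baseChange_a₁_eq_zero h1) (baseChange_a₂_eq_zero h2) (baseChange_a₃_eq_zero h3)
        (baseChange_a₄_eq_zero h4) h))
    (σ : absoluteGaloisGroup F) (hσ : σ • ω = ω ^ 2) (P : geomPoints V) :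
    σ • θ P = θ (θ (σ • P)) := by
  have hσ' : ((show AlgebraicClosure F ≃ₐ[F] AlgebraicClosure F from σ) :
      AlgebraicClosure F →ₐ[F] AlgebraicClosure F) ω = ω ^ 2 := hσ
  rcases P with _ | ⟨x, y, h⟩
  · change σ • θ 0 = θ (θ (σ • 0))
    rw [hθ0, smul_zero, hθ0, hθ0]
  · have eL : σ • θ (.some x y h) = Affine.Point.map ((show AlgebraicClosure F ≃ₐ[F]
        AlgebraicClosure F from σ) : AlgebraicClosure F →ₐ[F] AlgebraicClosure F)
        (θ (.some x y h)) := rfl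
    have eR : (σ • (show geomPoints V from .some x y h)) = Affine.Point.map
        ((show AlgebraicClosure F ≃ₐ[F] AlgebraicClosure F from σ) :
          AlgebraicClosure F →ₐ[F] AlgebraicClosure F) (.some x y h) := rfl
    change σ • θ (.some x y h) = θ (θ (σ • (show geomPoints V from .some x y h)))
    rw [eL, eR, hθ x y h, Affine.Point.map_some, Affine.Point.map_some, hθ, hθ]
    simp only [map_mul, hσ', pow_two, mul_assoc]

variable [V.IsElliptic]
include h1 h2 h3 h4 hω

/-- **`[ω]` on `E(F̄)` for an `F`-model `B ≅ V` of a Mordell equation, with its behaviour under all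
of `Γ_F`**: an additive `θ` with `θ² + θ + 1 = 0`, commuting with every `σ` fixing `ω` and
semilinear (`σθ = θ²σ`) for every `σ` with `σ(ω) = ω²`.
[cite: HuShuYin2019, p. 4 (the complex multiplication `[ω](x,y) = (ωx, y)`)] -/
theorem exists_omega_geomPoints_semilinear [CharZero F] {B : WeierstrassCurve F}
    {C : VariableChange F} (hCB : C • B = V) :
    ∃ θ : geomPoints B →+ geomPoints B, (∀ x, θ (θ x) + θ x + x = 0) ∧
      (∀ σ : absoluteGaloisGroup F, σ • ω = ω → ∀ x, σ • θ x = θ (σ • x)) ∧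
      (∀ σ : absoluteGaloisGroup F, σ • ω = ω ^ 2 → ∀ x, σ • θ x = θ (θ (σ • x))) := by
  subst hCB
  have h1' := baseChange_a₁_eq_zero (V := C • B) h1
  have h2' := baseChange_a₂_eq_zero (V := C • B) h2
  have h3' := baseChange_a₃_eq_zero (V := C • B) h3
  have h4' := baseChange_a₄_eq_zero (V := C • B) h4
  obtain ⟨θ', hθ'⟩ := SylvesterTwoCMNormForm.exists_omegaRot hω h1' h2' h3' h4'
  have hω1 : ω ≠ 1 := by
    rintro rfl
    norm_num at hω
  let θ₁ : geomPoints (C • B) →+ geomPoints (C • B) := θ'.toAddMonoidHom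
  have hθ₁0 : (θ₁ : geomPoints (C • B) → geomPoints (C • B)) 0 = 0 := map_zero θ'
  have hθ₁ : ∀ (x y : AlgebraicClosure F)
      (h : ((C • B).baseChange (AlgebraicClosure F)).toAffine.Nonsingular x y),
      (θ₁ : geomPoints (C • B) → geomPoints (C • B)) (.some x y h) = .some (ω * x) y
        (SylvesterTwoCMNormForm.nonsingular_omega_mul hω h1' h2' h3' h4' h) := hθ'
  have hrel : ∀ Q : geomPoints (C • B), θ₁ (θ₁ Q) + θ₁ Q + Q = 0 := fun Q =>
    SylvesterTwoCMNormForm.omegaRot_omegaRot_add_omegaRot_add hω h1' h2' h3' h4'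
      (θ := (θ₁ : geomPoints (C • B) → geomPoints (C • B))) hθ₁0 hθ₁ hω1 Q
  have hcomm : ∀ σ : absoluteGaloisGroup F, σ • ω = ω → ∀ Q : geomPoints (C • B),
      σ • θ₁ Q = θ₁ (σ • Q) := fun σ hσ Q =>
    smul_omegaRot_of_smul_omega h1 h2 h3 h4 hω (θ := (θ₁ : geomPoints (C • B) → geomPoints (C • B)))
      hθ₁0 hθ₁ σ hσ Q
  have hsemi : ∀ σ : absoluteGaloisGroup F, σ • ω = ω ^ 2 → ∀ Q : geomPoints (C • B),
      σ • θ₁ Q = θ₁ (θ₁ (σ • Q)) := fun σ hσ Q =>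
    smul_omegaRot_of_smul_omega_eq_sq h1 h2 h3 h4 hω
      (θ := (θ₁ : geomPoints (C • B) → geomPoints (C • B))) hθ₁0 hθ₁ σ hσ Q
  set e : geomPoints B ≃+ geomPoints (C • B) := geomPointsEquiv B C with he
  have hes : ∀ (σ : absoluteGaloisGroup F) (Q : geomPoints (C • B)),
      σ • e.symm Q = e.symm (σ • Q) := fun σ Q => by
    apply e.injective
    rw [he, geomPointsEquiv_smul, AddEquiv.apply_symm_apply, AddEquiv.apply_symm_apply]
  refine ⟨e.symm.toAddMonoidHom.comp (θ₁.comp e.toAddMonoidHom), fun x => ?_, fun σ hσ x => ?_,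
    fun σ hσ x => ?_⟩
  · change e.symm (θ₁ (e (e.symm (θ₁ (e x))))) + e.symm (θ₁ (e x)) + x = 0
    rw [e.apply_symm_apply]
    have h' := congrArg e.symm (hrel (e x))
    rwa [map_add, map_add, map_zero, e.symm_apply_apply] at h'
  · change σ • e.symm (θ₁ (e x)) = e.symm (θ₁ (e (σ • x)))
    rw [hes, hcomm σ hσ, he, geomPointsEquiv_smul]
  · change σ • e.symm (θ₁ (e x)) = e.symm (θ₁ (e (e.symm (θ₁ (e (σ • x))))))
    rw [e.apply_symm_apply, hes, hsemi σ hσ, he, geomPointsEquiv_smul]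

end Semilinear

/-! ## §2 The eigenspace structure of `E[2^M]` under an involution `σ` with `σ(ω) = ω²` -/

section Eigen

variable {F : Type u} [Field F] [NumberField F]

/-- **The `τ`-eigenspace structure of `E[2^M]` at `p = 2`** for an `F`-model `B` of a Mordell
curve `y² = x³ − c` and an INVOLUTION `σ ∈ Γ_F` with `σ(ω) = ω²` (complex conjugation when `F` is
real): with `N = E_B[2^M]`, `M ≥ 1`, there are `[ω] : N →+ N` and `P ∈ N` of order `2^M` fixed by
`σ` with `N^{σ=1} = ℤ/2^M·P`, `N^{σ=−1} = ℤ/2^M·(P + 2[ω]P)`, `2N ⊆ N⁺ + N⁻`, `[ω]P ∉ N⁺ + N⁻`: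
both eigenspaces cyclic of order `2^M`, `[N : N⁺ + N⁻] = 2`.  Replaces `E[p^M] = E[p^M]⁺ ⊕ E[p^M]⁻`
(McCallum 1991 §3, odd `p`) in the 2-adic line. [cite: McCallumLMS1991, §3 (the case p odd)] -/
theorem conj_eigen_structure_twoPow {c : F} (B : WeierstrassCurve F) [B.IsElliptic]
    {C : VariableChange F} (hCB : C • B = ⟨0, 0, 0, 0, -c⟩)
    {ω : AlgebraicClosure F} (hω : ω ^ 2 + ω + 1 = 0)
    (σ : absoluteGaloisGroup F) (hσω : σ • ω = ω ^ 2) (hσ2 : σ * σ = 1) {M : ℕ} (hM : 1 ≤ M) :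
    ∃ (θ : geomTorsion B ((2 ^ M : ℕ) : ℤ) →+ geomTorsion B ((2 ^ M : ℕ) : ℤ))
      (P : geomTorsion B ((2 ^ M : ℕ) : ℤ)),
      (∀ T, θ (θ T) + θ T + T = 0) ∧ (∀ T, σ • θ T = θ (θ (σ • T))) ∧
      addOrderOf P = 2 ^ M ∧ σ • P = P ∧
      (∀ T, σ • T = T ↔ ∃ a : ℤ, T = a • P) ∧
      (∀ T, σ • T = -T ↔ ∃ a : ℤ, T = a • (P + (2 : ℤ) • θ P)) ∧
      (∀ T, ∃ a b : ℤ, (2 : ℤ) • T = a • P + b • (P + (2 : ℤ) • θ P)) ∧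
      (∀ a b : ℤ, θ P ≠ a • P + b • (P + (2 : ℤ) • θ P)) := by
  haveI : NeZero (2 ^ M : ℕ) := ⟨pow_ne_zero _ two_ne_zero⟩
  haveI hV : (C • B).IsElliptic := inferInstance
  obtain ⟨θ, hθrel, -, hθsemi⟩ := exists_omega_geomPoints_semilinear (V := C • B) (by rw [hCB])
    (by rw [hCB]) (by rw [hCB]) (by rw [hCB]) hω rfl
  set m : ℕ := 2 ^ M with hm
  haveI : Finite (geomTorsion B (m : ℤ)) := B.finite_geomTorsion_nat (NeZero.ne m)
  have hmF : (m : F) ≠ 0 := by rw [hm]; exact_mod_cast pow_ne_zero M (two_ne_zero (α := F))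
  obtain ⟨P₀, hP₀⟩ := WeierstrassCurve.exists_addOrderOf_eq (W := B) hmF
  have hcard : Nat.card (geomTorsion B (m : ℤ)) = 4 ^ M := by
    rw [hm, card_geomTorsion_two_pow B two_ne_zero M, pow_mul]
    norm_num
  have hmem : ∀ Q : geomPoints B, Q ∈ geomTorsion B (m : ℤ) ↔ (m : ℤ) • Q = 0 := fun Q =>
    Submodule.mem_torsionBy_iff (m : ℤ) Q
  have hθmem : ∀ T : geomTorsion B (m : ℤ), θ (T : geomPoints B) ∈ geomTorsion B (m : ℤ) := by
    intro T
    rw [hmem, ← map_zsmul, (hmem _).mp T.2, map_zero]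
  let θN : geomTorsion B (m : ℤ) →+ geomTorsion B (m : ℤ) :=
    { toFun := fun T => ⟨θ T, hθmem T⟩
      map_zero' := Subtype.ext (by simp)
      map_add' := fun T T' => Subtype.ext (by simp) }
  have hθN : ∀ T : geomTorsion B (m : ℤ), θN (θN T) + θN T + T = 0 := fun T =>
    Subtype.ext (hθrel T)
  -- `σ` as an additive endomorphism of `N`: semilinear involution
  set τ : geomTorsion B (m : ℤ) →+ geomTorsion B (m : ℤ) := DistribSMul.toAddMonoidHom _ σ with hτ
  have hτθ : ∀ T, τ (θN T) = θN (θN (τ T)) := fun T => by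
    apply Subtype.ext
    simp only [hτ, DistribSMul.toAddMonoidHom_apply, AddSubgroup.torsionBy.coe_smul]
    exact hθsemi σ hσω T
  have hτ2 : ∀ T, τ (τ T) = T := fun T => by
    simp only [hτ, DistribSMul.toAddMonoidHom_apply, smul_smul, hσ2, one_smul]
  obtain ⟨P, hτP, hP⟩ :=
    EisensteinTorsion.exists_tau_fixed_addOrderOf_eq θN hθN τ hτθ hcard hP₀ hτ2 hM
  have hτP' : τ P = P := hτP
  refine ⟨θN, P, hθN, fun T => ?_, hP, hτP, fun T => ?_, fun T => ?_, fun T => ?_, fun a b => ?_⟩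
  · exact congrArg Subtype.val (hτθ T) |> fun h => Subtype.ext h
  · exact EisensteinTorsion.tau_eq_self_iff θN hθN τ hτθ hτP' hcard hP T
  · exact EisensteinTorsion.tau_eq_neg_iff θN hθN τ hτθ hτP' hcard hP T
  · exact EisensteinTorsion.two_smul_mem_eigen_sum θN hθN hcard hP T
  · exact EisensteinTorsion.theta_not_mem_eigen_sum θN hθN hP hM a b

end Eigen

end Summit.BirchSwinnertonDyer.BirchSwinnertonDyer.Theorems.SylvesterTwoUpper

end
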